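import Mathlib.RingTheory.Invariant.Profinite
import Mathlib.FieldTheory.Galois.Profinite
import Mathlib.FieldTheory.Galois.Infinite
import Mathlib.FieldTheory.KrullTopology
import Mathlib.FieldTheory.Fixed
import Literature.RingTheory.MvPolynomial.GeomComponentCountBaseChange
import HarnessLib

/-!
# The Galois action on the geometric irreducible components of an affine `k`-variety

Let `K/k` be a Galois extension (possibly infinite, e.g. `K = k̄` for `k` perfect) and let
`G = Gal(K/k)` act on `K[X_σ]` coefficientwise (`p ↦ pᵍ = map g p`).

* `Literature.RingTheory.MvPolynomial.exists_map_algEquiv_eq_of_comap_eq` — **transitivity**: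
  two prime ideals of `K[X_σ]` with the same contraction to `k[X_σ]` are conjugate under `G`
  (Stacks Project, Tag 04KY: the fibres of `IrredComp(X_K) → IrredComp(X)` are the
  `Gal`-orbits; here for all primes, via Mathlib's profinite invariant theory
  `Algebra.IsInvariant.exists_smul_of_under_eq_of_profinite` applied to `k[X] = K[X]^G`).
* `Literature.RingTheory.MvPolynomial.map_algEquiv_mem_minimalPrimes_map` — `G` permutes the
  minimal primes over `I K[X_σ]` for `I ⊆ k[X_σ]` (Stacks Project, Tag 038J/04KY).
* `Literature.RingTheory.MvPolynomial.map_algEquiv_eq_of_forall_apply_eq` — an element of `G`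
  fixing a point `y ∈ K^σ` fixes the UNIQUE minimal prime over `I K[X_σ]` inside `𝔪_y`, when
  there is a unique one.
* `Literature.RingTheory.MvPolynomial.ncard_minimalPrimes_map_le_finrank` and
  `exists_mem_minimalPrimes_ncard_map_le_finrank` — **orbit–stabiliser bound**: if `K` is moreover
  algebraically closed, `y ∈ E^σ` for an intermediate field `E` finite over `k`, and exactly one
  minimal prime `Q` over `I K[X_σ]` lies in `𝔪_y`, then `𝔭 = Q ∩ k[X_σ]` is a minimal prime over
  `I` whose extension `𝔭 K[X_σ]` has at most `[E : k]` minimal primes: they form the `G`-orbit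
  of `Q` (Tag 04KY), the stabiliser of `Q` contains `Gal(K/E)`, and
  `[G : Gal(K/E)] = #Hom_k(E, K) = [E : k]` (Stacks Project, Tag 04KZ (1), (3) for the finiteness
  / single-orbit statement). Geometrically: a `k`-component of `V(I)` carrying an `E`-rational
  point that lies on only one geometric component has at most `[E:k]` geometric components.

## References
* The Stacks Project, Tags 038J, 04KY, 04KZ (Section 33.8, geometrically irreducible schemes).
  [StacksProject]
* Q. Liu, *Algebraic Geometry and Arithmetic Curves*, OUP 2002, §3.2, Exercise 2.10. [Liu2002]
-/

noncomputable section

open MvPolynomial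
open scoped Pointwise

namespace Literature.RingTheory.MvPolynomial

variable {k : Type*} [Field k] {K : Type*} [Field K] [Algebra k K] {σ : Type*}

/-! ### The coefficientwise action -/

/-- A polynomial all of whose coefficients are fixed by `g ∈ Gal(K/k)` is fixed by `map g`.
[folklore] -/
private theorem map_algEquiv_eq_self_of_forall_coeff (g : K ≃ₐ[k] K) (p : MvPolynomial σ K)
    (h : ∀ c ∈ p.coeffs, g c = c) : MvPolynomial.map (g : K →+* K) p = p := by
  classical
  ext m
  rw [MvPolynomial.coeff_map]
  by_cases hm : p.coeff m = 0
  · rw [hm]; exact map_zero _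
  · exact h _ (MvPolynomial.coeff_mem_coeffs m hm)

/-- `map g` commutes with the structure map `k[X_σ] → K[X_σ]` for `g ∈ Gal(K/k)`. [folklore] -/
private theorem map_algEquiv_comp_map_algebraMap (g : K ≃ₐ[k] K) :
    (MvPolynomial.map (σ := σ) (g : K →+* K)).comp (MvPolynomial.map (algebraMap k K)) =
      MvPolynomial.map (algebraMap k K) := by
  have hga : (g : K →+* K).comp (algebraMap k K) = algebraMap k K :=
    RingHom.ext fun x => g.commutes x
  exact RingHom.ext fun p => by rw [RingHom.comp_apply, MvPolynomial.map_map, hga]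

/-- `map (g * h) = map g ∘ map h`. [folklore] -/
private theorem map_algEquiv_mul (g h : K ≃ₐ[k] K) :
    MvPolynomial.map (σ := σ) ((g * h : K ≃ₐ[k] K) : K →+* K) =
      (MvPolynomial.map (g : K →+* K)).comp (MvPolynomial.map (h : K →+* K)) := by
  refine RingHom.ext fun p => ?_
  rw [RingHom.comp_apply, MvPolynomial.map_map]
  rfl

/-- The extended ideal `I K[X_σ]` of an ideal `I ⊆ k[X_σ]` is stable under `Gal(K/k)`.
[folklore] -/
private theorem map_map_algEquiv_eq (g : K ≃ₐ[k] K) (I : Ideal (MvPolynomial σ k)) :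
    (I.map (MvPolynomial.map (algebraMap k K))).map (MvPolynomial.map (σ := σ) (g : K →+* K)) =
      I.map (MvPolynomial.map (algebraMap k K)) := by
  rw [Ideal.map_map, map_algEquiv_comp_map_algebraMap]

/-! ### Transitivity -/

/-- **`Gal(K/k)` acts transitively on the primes of `K[X_σ]` over a given prime of `k[X_σ]`**
(`K/k` Galois, possibly infinite): if `P, Q ⊆ K[X_σ]` are prime ideals with
`P ∩ k[X_σ] = Q ∩ k[X_σ]`, then `Q = Pᵍ` for some `g ∈ Gal(K/k)`. In particular the fibres of
`IrredComp(V(I)_K) → IrredComp(V(I))` are the `Gal(K/k)`-orbits. Proof: `k[X] = K[X]^G` for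
the coefficientwise (continuous, for the Krull topology) action of the profinite group `G`, so
Mathlib's `Algebra.IsInvariant.exists_smul_of_under_eq_of_profinite` applies.
[cite: StacksProject, Tag 04KY] -/
theorem exists_map_algEquiv_eq_of_comap_eq [IsGalois k K] (P Q : Ideal (MvPolynomial σ K))
    [P.IsPrime] [Q.IsPrime]
    (h : P.comap (MvPolynomial.map (algebraMap k K)) = Q.comap (MvPolynomial.map (algebraMap k K))) :
    ∃ g : K ≃ₐ[k] K, Q = P.map (MvPolynomial.map (g : K →+* K)) := by
  classical
  letI : Algebra (MvPolynomial σ k) (MvPolynomial σ K) := MvPolynomial.algebraMvPolynomial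
  -- the coefficientwise Galois action (Mathlib's `AddMonoidAlgebra.distribMulAction`) is `map g`
  have hsmul : ∀ (g : K ≃ₐ[k] K) (p : MvPolynomial σ K),
      g • p = MvPolynomial.map (g : K →+* K) p := fun g p => by
    ext m
    rw [MvPolynomial.coeff_smul, MvPolynomial.coeff_map]
    rfl
  letI act : MulSemiringAction (K ≃ₐ[k] K) (MvPolynomial σ K) :=
    { (inferInstance : DistribMulAction (K ≃ₐ[k] K) (MvPolynomial σ K)) with
      smul_one := fun g => by rw [hsmul]; exact map_one _
      smul_mul := fun g p q => by rw [hsmul, hsmul, hsmul]; exact map_mul _ _ _ }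
  letI : TopologicalSpace (MvPolynomial σ K) := ⊥
  haveI : DiscreteTopology (MvPolynomial σ K) := ⟨rfl⟩
  haveI : SMulCommClass (K ≃ₐ[k] K) (MvPolynomial σ k) (MvPolynomial σ K) := by
    refine ⟨fun g a p => ?_⟩
    rw [Algebra.smul_def, Algebra.smul_def, MvPolynomial.algebraMap_def]
    change MvPolynomial.map (g : K →+* K) (MvPolynomial.map (algebraMap k K) a * p) =
      MvPolynomial.map (algebraMap k K) a * MvPolynomial.map (g : K →+* K) p
    have hga : (g : K →+* K).comp (algebraMap k K) = algebraMap k K :=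
      RingHom.ext fun x => g.commutes x
    rw [map_mul, MvPolynomial.map_map, hga]
  haveI : ContinuousSMul (K ≃ₐ[k] K) (MvPolynomial σ K) := by
    refine ⟨continuous_prod_of_discrete_right.2 fun p => ?_⟩
    refine continuous_discrete_rng.2 fun q => ?_
    rw [isOpen_iff_forall_mem_open]
    intro g₀ hg₀
    -- the finite extension generated by the coefficients of `p`
    set E : IntermediateField k K := IntermediateField.adjoin k (↑p.coeffs : Set K) with hE
    haveI : FiniteDimensional k E :=
      IntermediateField.finiteDimensional_adjoin fun x _ => Algebra.IsIntegral.isIntegral x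
    refine ⟨g₀ • (E.fixingSubgroup : Set (K ≃ₐ[k] K)), ?_, (E.fixingSubgroup_isOpen).leftCoset g₀,
      ⟨1, E.fixingSubgroup.one_mem, mul_one g₀⟩⟩
    rintro x ⟨g, hg, rfl⟩
    have hgE : ∀ c ∈ p.coeffs, g c = c := fun c hc =>
      (IntermediateField.mem_fixingSubgroup_iff E g).1 hg c (IntermediateField.subset_adjoin k _ hc)
    change (g₀ * g) • p ∈ ({q} : Set (MvPolynomial σ K))
    have hp : g • p = p := by rw [hsmul]; exact map_algEquiv_eq_self_of_forall_coeff g p hgE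
    rw [mul_smul, hp]
    exact hg₀
  haveI : Algebra.IsInvariant (MvPolynomial σ k) (MvPolynomial σ K) (K ≃ₐ[k] K) := by
    refine ⟨fun b hb => ?_⟩
    have hb' : b ∈ Set.range (MvPolynomial.map (algebraMap k K)) := by
      rw [MvPolynomial.mem_range_map_iff_coeffs_subset]
      intro c hc
      obtain ⟨n, -, rfl⟩ := MvPolynomial.mem_coeffs_iff.1 hc
      have hfix : ∀ g : K ≃ₐ[k] K, g (b.coeff n) = b.coeff n := fun g => by
        have h1 : MvPolynomial.map (g : K →+* K) b = b := by rw [← hsmul]; exact hb g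
        have h2 := congr_arg (MvPolynomial.coeff n) h1
        rwa [MvPolynomial.coeff_map] at h2
      exact IntermediateField.mem_bot.1 ((InfiniteGalois.mem_bot_iff_fixed (b.coeff n)).2 hfix)
    obtain ⟨a, ha⟩ := hb'
    exact ⟨a, ha⟩
  obtain ⟨g, hg⟩ := Algebra.IsInvariant.exists_smul_of_under_eq_of_profinite
    (A := MvPolynomial σ k) (G := K ≃ₐ[k] K) P Q (by rw [Ideal.under_def, Ideal.under_def]; exact h)
  refine ⟨g, ?_⟩
  rw [hg, Ideal.pointwise_smul_def]
  congr 1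

/-! ### The action on the minimal primes over `I K[X_σ]` -/

/-- `Gal(K/k)` permutes the minimal primes over `I K[X_σ]` (`I ⊆ k[X_σ]`): if `Q` is one, so
is `Qᵍ`. [cite: StacksProject, Tag 038J] -/
theorem map_algEquiv_mem_minimalPrimes_map (g : K ≃ₐ[k] K) (I : Ideal (MvPolynomial σ k))
    {Q : Ideal (MvPolynomial σ K)}
    (hQ : Q ∈ (I.map (MvPolynomial.map (algebraMap k K))).minimalPrimes) :
    Q.map (MvPolynomial.map (g : K →+* K)) ∈
      (I.map (MvPolynomial.map (algebraMap k K))).minimalPrimes := by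
  haveI : Q.IsPrime := hQ.1.1
  -- `map g` is a ring automorphism with inverse `map g⁻¹`
  set e : MvPolynomial σ K ≃+* MvPolynomial σ K := MvPolynomial.mapEquiv σ (g : K ≃+* K) with he
  have hecoe : (e : MvPolynomial σ K →+* MvPolynomial σ K) = MvPolynomial.map (g : K →+* K) :=
    RingHom.ext fun p => rfl
  have hmap : ∀ J : Ideal (MvPolynomial σ K),
      J.map (MvPolynomial.map (g : K →+* K)) = J.map (e : MvPolynomial σ K →+* MvPolynomial σ K) :=
    fun J => by rw [hecoe]
  rw [hmap]
  refine ⟨⟨Ideal.map_isPrime_of_equiv e, ?_⟩, ?_⟩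
  · -- `I K[X] = (I K[X])ᵍ ≤ Qᵍ`
    have := Ideal.map_mono (f := (e : MvPolynomial σ K →+* MvPolynomial σ K)) hQ.1.2
    rwa [← hmap, map_map_algEquiv_eq] at this
  · rintro P ⟨hP, hIP⟩ hPQ
    -- pull back along `e`
    have h1 : P.map (e.symm : MvPolynomial σ K →+* MvPolynomial σ K) ≤ Q := by
      have := Ideal.map_mono (f := (e.symm : MvPolynomial σ K →+* MvPolynomial σ K)) hPQ
      rwa [Ideal.map_map, show (↑e.symm : MvPolynomial σ K →+* MvPolynomial σ K).comp ↑e =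
        RingHom.id _ from RingHom.ext fun p => e.symm_apply_apply p, Ideal.map_id] at this
    have h2 : I.map (MvPolynomial.map (algebraMap k K)) ≤
        P.map (e.symm : MvPolynomial σ K →+* MvPolynomial σ K) := by
      have := Ideal.map_mono (f := (e.symm : MvPolynomial σ K →+* MvPolynomial σ K)) hIP
      have hsymm : (e.symm : MvPolynomial σ K →+* MvPolynomial σ K) =
          MvPolynomial.map ((g⁻¹ : K ≃ₐ[k] K) : K →+* K) := RingHom.ext fun p => rfl
      rwa [hsymm, map_map_algEquiv_eq] at this
    haveI : (P.map (e.symm : MvPolynomial σ K →+* MvPolynomial σ K)).IsPrime :=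
      Ideal.map_isPrime_of_equiv e.symm
    have h3 : P.map (e.symm : MvPolynomial σ K →+* MvPolynomial σ K) = Q :=
      le_antisymm h1 (hQ.2 ⟨inferInstance, h2⟩ h1)
    rw [← h3, Ideal.map_map, show (↑e : MvPolynomial σ K →+* MvPolynomial σ K).comp ↑e.symm =
      RingHom.id _ from RingHom.ext fun p => e.apply_symm_apply p, Ideal.map_id]

/-- For a PRIME `𝔭 ⊆ k[X_σ]` and `K/k` Galois, the minimal primes over `𝔭 K[X_σ]` form a
single `Gal(K/k)`-orbit: any two are conjugate. [cite: StacksProject, Tag 04KY] -/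
theorem exists_map_algEquiv_eq_of_mem_minimalPrimes_map [IsGalois k K]
    (𝔭 : Ideal (MvPolynomial σ k)) [𝔭.IsPrime] {Q Q' : Ideal (MvPolynomial σ K)}
    (hQ : Q ∈ (𝔭.map (MvPolynomial.map (algebraMap k K))).minimalPrimes)
    (hQ' : Q' ∈ (𝔭.map (MvPolynomial.map (algebraMap k K))).minimalPrimes) :
    ∃ g : K ≃ₐ[k] K, Q' = Q.map (MvPolynomial.map (g : K →+* K)) := by
  haveI : Q.IsPrime := hQ.1.1
  haveI : Q'.IsPrime := hQ'.1.1
  exact exists_map_algEquiv_eq_of_comap_eq Q Q'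
    (by rw [comap_eq_of_mem_minimalPrimes_map 𝔭 hQ, comap_eq_of_mem_minimalPrimes_map 𝔭 hQ'])

/-! ### Points fixed by the Galois action -/

/-- `ev_y (pᵍ) = g (ev_y p)` when `g` fixes the point `y`. [folklore] -/
private theorem aeval_map_algEquiv_of_forall_apply_eq (g : K ≃ₐ[k] K) (y : σ → K)
    (hy : ∀ v, g (y v) = y v) (p : MvPolynomial σ K) :
    MvPolynomial.aeval y (MvPolynomial.map (g : K →+* K) p) = g (MvPolynomial.aeval y p) := by
  rw [MvPolynomial.aeval_def, MvPolynomial.eval₂_map, MvPolynomial.aeval_def,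
    show (g (MvPolynomial.eval₂ (algebraMap K K) y p)) =
      (g : K →+* K) (MvPolynomial.eval₂ (algebraMap K K) y p) from rfl,
    MvPolynomial.eval₂_comp_left]
  congr 1
  ext v
  exact (hy v).symm

/-- **The stabiliser of the component through a fixed point.** If `g ∈ Gal(K/k)` fixes the point
`y ∈ K^σ` and exactly one minimal prime `Q` over `I K[X_σ]` lies in `𝔪_y = ker (ev_y)`, then
`Qᵍ = Q` (`Qᵍ` is again a minimal prime over `I K[X_σ]` and lies in `𝔪_{g y} = 𝔪_y`).
[cite: StacksProject, Tag 04KZ] -/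
theorem map_algEquiv_eq_of_forall_apply_eq (g : K ≃ₐ[k] K) (I : Ideal (MvPolynomial σ k))
    (y : σ → K) (hy : ∀ v, g (y v) = y v) {Q : Ideal (MvPolynomial σ K)}
    (hQ : Q ∈ (I.map (MvPolynomial.map (algebraMap k K))).minimalPrimes)
    (huniq : ∀ Q' ∈ (I.map (MvPolynomial.map (algebraMap k K))).minimalPrimes,
      Q' ≤ RingHom.ker (MvPolynomial.aeval (R := K) y) → Q' = Q)
    (hQy : Q ≤ RingHom.ker (MvPolynomial.aeval (R := K) y)) :
    Q.map (MvPolynomial.map (g : K →+* K)) = Q := by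
  refine huniq _ (map_algEquiv_mem_minimalPrimes_map g I hQ) ?_
  rw [Ideal.map_le_iff_le_comap]
  intro p hp
  have h1 : MvPolynomial.aeval y p = 0 := (RingHom.mem_ker).1 (hQy hp)
  rw [Ideal.mem_comap, RingHom.mem_ker, aeval_map_algEquiv_of_forall_apply_eq g y hy, h1, map_zero]

/-! ### The orbit–stabiliser bound -/

/-- **A `k`-component with an `E`-rational point on a unique geometric component has at most
`[E:k]` geometric components.** Let `K ⊇ k` be algebraically closed and Galois over `k` (e.g.
`K = k̄`, `k` perfect), `E` an intermediate field finite over `k`, `y ∈ E^σ`, `I ⊆ k[X_σ]`, and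
suppose exactly one minimal prime `Q` over `I K[X_σ]` lies in `𝔪_y`. Then for `𝔭 = Q ∩ k[X_σ]`
the number of minimal primes over `𝔭 K[X_σ]` is at most `[E : k]`: they form the
`Gal(K/k)`-orbit of `Q` (Tag 04KY), `Qᵍ` depends only on `g|_E` since `Gal(K/E)` stabilises
`Q`, and there are `#Hom_k(E,K) = [E:k]` restrictions. [cite: StacksProject, Tag 04KZ] -/
theorem ncard_minimalPrimes_map_le_finrank [IsGalois k K] [IsAlgClosed K]
    (I : Ideal (MvPolynomial σ k)) (y : σ → K) (E : IntermediateField k K)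
    [FiniteDimensional k E] (hyE : ∀ v, y v ∈ E) {Q : Ideal (MvPolynomial σ K)}
    (hQ : Q ∈ (I.map (MvPolynomial.map (algebraMap k K))).minimalPrimes)
    (hQy : Q ≤ RingHom.ker (MvPolynomial.aeval (R := K) y))
    (huniq : ∀ Q' ∈ (I.map (MvPolynomial.map (algebraMap k K))).minimalPrimes,
      Q' ≤ RingHom.ker (MvPolynomial.aeval (R := K) y) → Q' = Q) :
    (((Q.comap (MvPolynomial.map (algebraMap k K))).map
        (MvPolynomial.map (algebraMap k K))).minimalPrimes).ncard ≤ Module.finrank k E := by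
  classical
  haveI : Q.IsPrime := hQ.1.1
  set 𝔭 : Ideal (MvPolynomial σ k) := Q.comap (MvPolynomial.map (algebraMap k K)) with h𝔭
  haveI : 𝔭.IsPrime := Ideal.comap_isPrime _ Q
  have hQ𝔭 : Q ∈ (𝔭.map (MvPolynomial.map (algebraMap k K))).minimalPrimes :=
    mem_minimalPrimes_map_comap_of_mem_minimalPrimes_map I hQ
  -- the orbit map and the restriction map
  let orb : (K ≃ₐ[k] K) → Ideal (MvPolynomial σ K) := fun g => Q.map (MvPolynomial.map (g : K →+* K))
  let res : (K ≃ₐ[k] K) → (E →ₐ[k] K) := fun g => (g : K →ₐ[k] K).comp E.val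
  -- `orb` factors through `res`
  have hfac : ∀ g₁ g₂, res g₁ = res g₂ → orb g₁ = orb g₂ := by
    intro g₁ g₂ hres
    have hfix : ∀ v, (g₁⁻¹ * g₂) (y v) = y v := fun v => by
      have h1 : g₁ (y v) = g₂ (y v) := by
        have := congr_arg (fun f : E →ₐ[k] K => f ⟨y v, hyE v⟩) hres
        exact this
      rw [AlgEquiv.mul_apply, ← h1]
      exact g₁.symm_apply_apply (y v)
    have hstab := map_algEquiv_eq_of_forall_apply_eq (g₁⁻¹ * g₂) I y hfix hQ huniq hQy
    have hg₂ : g₂ = g₁ * (g₁⁻¹ * g₂) := by group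
    change Q.map _ = Q.map _
    conv_rhs => rw [hg₂, map_algEquiv_mul, ← Ideal.map_map, hstab]
  -- a section of `res` on its image, by choice
  let lift : (E →ₐ[k] K) → Ideal (MvPolynomial σ K) := fun ψ =>
    if hψ : ∃ g, res g = ψ then orb hψ.choose else ⊥
  have hlift : ∀ g, lift (res g) = orb g := fun g => by
    have hψ : ∃ g', res g' = res g := ⟨g, rfl⟩
    simp only [lift, dif_pos hψ]
    exact hfac _ _ hψ.choose_spec
  -- every minimal prime over `𝔭 K[X]` is in the orbit, hence in the range of `lift`
  have hsub : (𝔭.map (MvPolynomial.map (algebraMap k K))).minimalPrimes ⊆ Set.range lift := by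
    intro Q' hQ'
    obtain ⟨g, hg⟩ := exists_map_algEquiv_eq_of_mem_minimalPrimes_map 𝔭 hQ𝔭 hQ'
    exact ⟨res g, by rw [hlift, hg]⟩
  -- count
  haveI : Algebra.IsSeparable k E := IntermediateField.isSeparable_tower_bot k E
  calc ((𝔭.map (MvPolynomial.map (algebraMap k K))).minimalPrimes).ncard
      ≤ (Set.range lift).ncard := Set.ncard_le_ncard hsub (Set.finite_range lift)
    _ = (lift '' Set.univ).ncard := by rw [Set.image_univ]
    _ ≤ (Set.univ : Set (E →ₐ[k] K)).ncard := Set.ncard_image_le Set.finite_univ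
    _ = Fintype.card (E →ₐ[k] K) := by rw [Set.ncard_univ, Nat.card_eq_fintype_card]
    _ = Module.finrank k E := AlgHom.card k E K

/-- **Component descent** (the form used by route `ValiantsHypothesis/LangWeilTransfer`, crux
`ShatteringExclusion`, stub `ComponentDescent`, over a general algebraically closed Galois
extension `K/k`): for `I ⊆ k[X_σ]` (`σ` finite), `E/k` finite inside `K`, and a point
`y ∈ E^σ` lying on exactly one irreducible component of `V(I)_K`, some minimal prime `𝔭 ⊇ I` has
`0 < #IrredComp(V(𝔭)_K) ≤ [E : k]`. [cite: StacksProject, Tag 04KZ] -/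
theorem exists_mem_minimalPrimes_ncard_map_le_finrank [IsGalois k K] [IsAlgClosed K] [Finite σ]
    (I : Ideal (MvPolynomial σ k)) (y : σ → K) (E : IntermediateField k K)
    [FiniteDimensional k E] (hyE : ∀ v, y v ∈ E)
    (huniq : ∃! Q : Ideal (MvPolynomial σ K),
      Q ∈ (I.map (MvPolynomial.map (algebraMap k K))).minimalPrimes ∧
        Q ≤ RingHom.ker (MvPolynomial.aeval (R := K) y)) :
    ∃ 𝔭 ∈ I.minimalPrimes,
      0 < ((𝔭.map (MvPolynomial.map (algebraMap k K))).minimalPrimes).ncard ∧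
        ((𝔭.map (MvPolynomial.map (algebraMap k K))).minimalPrimes).ncard ≤ Module.finrank k E := by
  obtain ⟨Q, ⟨hQ, hQy⟩, huniq⟩ := huniq
  refine ⟨Q.comap (MvPolynomial.map (algebraMap k K)),
    comap_mem_minimalPrimes_of_mem_minimalPrimes_map I hQ, ?_,
    ncard_minimalPrimes_map_le_finrank I y E hyE hQ hQy fun Q' hQ' hQ'y => huniq Q' ⟨hQ', hQ'y⟩⟩
  -- positivity: `Q` itself is a minimal prime over `𝔭 K[X]`, and there are finitely many
  have hmem := mem_minimalPrimes_map_comap_of_mem_minimalPrimes_map I hQ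
  have hfin : ((Q.comap (MvPolynomial.map (algebraMap k K))).map
      (MvPolynomial.map (algebraMap k K))).minimalPrimes.Finite :=
    Ideal.finite_minimalPrimes_of_isNoetherianRing (MvPolynomial σ K) _
  exact (Set.ncard_pos hfin).2 ⟨Q, hmem⟩

/-! ### The geometric components of a `k`-component form one Galois orbit -/

/-- **The minimal primes over `𝔭 K[X_σ]` are exactly the `Gal(K/k)`-orbit of any one of them**
(`𝔭 ⊆ k[X_σ]` prime, `K/k` Galois): transitivity (Tag 04KY) and stability of the set of minimal
primes under the action. [cite: StacksProject, Tag 04KZ] -/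
theorem minimalPrimes_map_eq_range_map_algEquiv [IsGalois k K] (𝔭 : Ideal (MvPolynomial σ k))
    [𝔭.IsPrime] {Q : Ideal (MvPolynomial σ K)}
    (hQ : Q ∈ (𝔭.map (MvPolynomial.map (algebraMap k K))).minimalPrimes) :
    (𝔭.map (MvPolynomial.map (algebraMap k K))).minimalPrimes =
      Set.range fun g : K ≃ₐ[k] K => Q.map (MvPolynomial.map (g : K →+* K)) := by
  ext Q'
  constructor
  · intro hQ'
    obtain ⟨g, hg⟩ := exists_map_algEquiv_eq_of_mem_minimalPrimes_map 𝔭 hQ hQ'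
    exact ⟨g, hg.symm⟩
  · rintro ⟨g, rfl⟩
    exact map_algEquiv_mem_minimalPrimes_map g 𝔭 hQ

/-- Hence **the geometric number of irreducible components of a `k`-component `V(𝔭)` is the size
of the `Gal(k̄/k)`-orbit of any one geometric component** (`k` of characteristic zero, so that
`k̄/k` is Galois; the orbit description of Görtz–Wedhorn Prop. 5.50 / Stacks Tag 04KZ (3)).
[cite: StacksProject, Tag 04KZ] -/
theorem geomComponentCount_eq_ncard_range_map_algEquiv [CharZero k] (𝔭 : Ideal (MvPolynomial σ k))
    [𝔭.IsPrime] {Q : Ideal (MvPolynomial σ (AlgebraicClosure k))}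
    (hQ : Q ∈ (𝔭.map (MvPolynomial.map (algebraMap k (AlgebraicClosure k)))).minimalPrimes) :
    geomComponentCount 𝔭 =
      (Set.range fun g : AlgebraicClosure k ≃ₐ[k] AlgebraicClosure k =>
        Q.map (MvPolynomial.map (g : AlgebraicClosure k →+* AlgebraicClosure k))).ncard := by
  rw [geomComponentCount_def, minimalPrimes_map_eq_range_map_algEquiv 𝔭 hQ]

end Literature.RingTheory.MvPolynomial

end
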